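import Literature.Topology.FourManifolds.ToricBlowupProjectivePlane
import Literature.Topology.FourManifolds.NeckCapping
import HarnessLib

/-!
# The neck of the toric model: expansion of the first summand, the two ranges, the neck map

Fifth file on the toric model `Ṽ = ToricBlowup.Model` of `Bl_p(S² × ℝ²)`. In the polar
blow-up coordinates `liftDisc : ℝ⁴ ∖ 0 → Ṽ` (`ToricBlowupPolar.lean`) and with the profiles of
`GluckNeckProfiles.lean` we set up the data of the neck recognition principle
`Literature.Topology.FourManifolds.isConnectedSum_of_neck` inside `Ṽ` (it is applied, in the next files, inside the
manifold obtained by gluing `Ṽ` to the complement of a 2-knot):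

* `ToricBlowup.ΘB` (`ΘBPH`) — **the expansion of `B ∖ {p}`**, `B = 𝕊 2 × ℝ²`: the radial
  expansion `neckExpansion` (profile `η̃`, the identity for radius `≥ 3/4`) in the disc `discB`,
  extended by the identity; an open partial diffeomorphism `B ∖ {p} ≅ B ∖ discB(B̄(0, 1/8))`,
  equal to the identity where `‖w‖ ≥ 3/4` (`ΘB_eq_self_of_norm_snd`);
* `ToricBlowup.rangeOne = sFibre ∪ {bdRad > 1/8} ∖ E` — the image `toModel (ΘB (B ∖ {p}))`
  (`toModel_ΘB_mem_rangeOne`, `exists_eq_toModel_ΘB`), which contains `toModel` of the end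
  `{‖w‖ > 1}` (`toModel_mem_rangeOne_of_norm_snd`) and is disjoint from the range
  `{bdRad < 1/8} ∖ sFibre` of `eTwo`;
* the **middle sphere** `liftDisc (8⁻¹ • θ)`: the points in neither range
  (`exists_eq_liftDisc_of_not_mem`);
* `ToricBlowup.neckV (θ, t) = liftDisc (γ t • θ)` (`neckVPH`, an open partial diffeomorphism
  `S³ × ℝ ≅ Ṽ ∖ (sFibre ∪ E)`, smooth with smooth inverse), and the **matchings**
  `toModel (ΘB (discB (t • θ))) = neckV (θ, t)` (`toModel_ΘB_discB_smul`) and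
  `eTwo ((affineChart 2).symm (t • θ)) = neckV (θ, -t)` (`eTwo_affine₂_smul'`) for `t > 0`.

All statements are proved; no manifold-structure facts beyond those of the previous files and
Mathlib's sphere are used.
-/

noncomputable section

open scoped Manifold ContDiff Topology ComplexConjugate
open Set Function Metric Module Complex

namespace Literature.Topology.FourManifolds

/-- Local notation: `𝔼 n` is the model Euclidean space `EuclideanSpace ℝ (Fin n)`. -/
local notation "𝔼 " n:arg => EuclideanSpace ℝ (Fin n)

/-- Local notation: `𝕊 n` is the unit sphere in `EuclideanSpace ℝ (Fin (n + 1))`. -/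
local notation "𝕊 " n:arg => (Metric.sphere (0 : EuclideanSpace ℝ (Fin (n + 1))) 1)

namespace ToricBlowup

open SphereCoord

/-! ### The expansion of `B ∖ {p}` -/

/-- **The expansion of the punctured `B`**: the radial expansion of the disc at `p` (profile `η̃`,
identity for radius `≥ 3/4`), extended by the identity over the south-pole fibre. [folklore] -/
def ΘB (b : (𝕊 2) × 𝔼 2) : (𝕊 2) × 𝔼 2 :=
  if b.1 = southPole then b else discB (neckExpansion (discBInv b))

/-- The inverse expansion. [folklore] -/
def ΘBInv (b : (𝕊 2) × 𝔼 2) : (𝕊 2) × 𝔼 2 :=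
  if b.1 = southPole then b else discB (neckExpansionInv (discBInv b))

/-- `ΘB` is the identity over the south pole. [folklore] -/
theorem ΘB_of_fst_eq {b : (𝕊 2) × 𝔼 2} (h : b.1 = southPole) : ΘB b = b := by rw [ΘB, if_pos h]

/-- `ΘBInv` is the identity over the south pole. [folklore] -/
theorem ΘBInv_of_fst_eq {b : (𝕊 2) × 𝔼 2} (h : b.1 = southPole) : ΘBInv b = b := by
  rw [ΘBInv, if_pos h]

/-- **`ΘB` in the disc**: `ΘB (discB v) = discB (neckExpansion v)`. [folklore] -/
theorem ΘB_discB (v : 𝔼 4) : ΘB (discB v) = discB (neckExpansion v) := by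
  rw [ΘB, if_neg (discB_fst_ne_southPole v), discBInv_discB]

/-- `ΘBInv` in the disc. [folklore] -/
theorem ΘBInv_discB (v : 𝔼 4) : ΘBInv (discB v) = discB (neckExpansionInv v) := by
  rw [ΘBInv, if_neg (discB_fst_ne_southPole v), discBInv_discB]

/-- Off the south pole, `ΘB b = discB (neckExpansion (discBInv b))`. [folklore] -/
theorem ΘB_of_fst_ne {b : (𝕊 2) × 𝔼 2} (h : b.1 ≠ southPole) :
    ΘB b = discB (neckExpansion (discBInv b)) := by rw [ΘB, if_neg h]

/-- The disc parameter has norm at least the fibre coordinate: `‖w‖ ≤ ‖discBInv (x, w)‖`.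
[folklore] -/
theorem norm_snd_le_norm_discBInv {b : (𝕊 2) × 𝔼 2} (h : b.1 ≠ southPole) : ‖b.2‖ ≤ ‖discBInv b‖ := by
  conv_lhs => rw [← discB_discBInv h]
  exact norm_discB_snd_le _

/-- **`ΘB` is the identity where `‖w‖ ≥ 3/4`** (in particular on the end `‖w‖ > 1`). [folklore] -/
theorem ΘB_eq_self_of_norm_snd {b : (𝕊 2) × 𝔼 2} (h : 3 / 4 ≤ ‖b.2‖) : ΘB b = b := by
  by_cases hS : b.1 = southPole
  · exact ΘB_of_fst_eq hS
  · rw [ΘB_of_fst_ne hS, neckExpansion_eq_self (h.trans (norm_snd_le_norm_discBInv hS)),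
      discB_discBInv hS]

/-- `ΘB` is the identity where the disc radius is `≥ 3/4`. [folklore] -/
theorem ΘB_eq_self_of_norm_discBInv {b : (𝕊 2) × 𝔼 2} (hS : b.1 ≠ southPole)
    (h : 3 / 4 ≤ ‖discBInv b‖) : ΘB b = b := by
  rw [ΘB_of_fst_ne hS, neckExpansion_eq_self h, discB_discBInv hS]

/-- `ΘBInv (ΘB b) = b` for `b ≠ p`. [folklore] -/
theorem ΘBInv_ΘB {b : (𝕊 2) × 𝔼 2} (hb : b ≠ basePt) : ΘBInv (ΘB b) = b := by
  by_cases hS : b.1 = southPole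
  · rw [ΘB_of_fst_eq hS, ΘBInv_of_fst_eq hS]
  · have h0 : discBInv b ≠ 0 := by
      intro h0; apply hb
      rw [← discB_discBInv hS, h0, discB_zero]
    rw [ΘB_of_fst_ne hS, ΘBInv_discB, neckExpansionInv_neckExpansion h0, discB_discBInv hS]

/-- `ΘB (ΘBInv b) = b` off `discB (B̄(0, 1/8))`. [folklore] -/
theorem ΘB_ΘBInv {b : (𝕊 2) × 𝔼 2} (hb : b ∉ discB '' closedBall (0 : 𝔼 4) 8⁻¹) : ΘB (ΘBInv b) = b := by
  by_cases hS : b.1 = southPole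
  · rw [ΘBInv_of_fst_eq hS, ΘB_of_fst_eq hS]
  · have h8 : 8⁻¹ < ‖discBInv b‖ := by
      by_contra hle
      push Not at hle
      exact hb ⟨discBInv b, by simpa using hle, discB_discBInv hS⟩
    rw [ΘBInv, if_neg hS, ΘB_discB, neckExpansion_neckExpansionInv h8, discB_discBInv hS]

/-- `ΘB` maps `B ∖ {p}` off `discB (B̄(0, 1/8))`. [folklore] -/
theorem ΘB_not_mem {b : (𝕊 2) × 𝔼 2} (hb : b ≠ basePt) : ΘB b ∉ discB '' closedBall (0 : 𝔼 4) 8⁻¹ := by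
  rintro ⟨v, hv, hvb⟩
  by_cases hS : b.1 = southPole
  · rw [ΘB_of_fst_eq hS] at hvb
    exact discB_fst_ne_southPole v (by rw [hvb]; exact hS)
  · have h0 : discBInv b ≠ 0 := by
      intro h0; apply hb
      rw [← discB_discBInv hS, h0, discB_zero]
    rw [ΘB_of_fst_ne hS] at hvb
    have := discB_injective hvb
    have hlt := lt_norm_neckExpansion h0
    rw [← this] at hlt
    exact not_le.2 hlt (by simpa using hv)

/-- `ΘBInv` maps the complement of `discB (B̄(0, 1/8))` into `B ∖ {p}`. [folklore] -/
theorem ΘBInv_ne_basePt {b : (𝕊 2) × 𝔼 2} (hb : b ∉ discB '' closedBall (0 : 𝔼 4) 8⁻¹) :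
    ΘBInv b ≠ basePt := by
  by_cases hS : b.1 = southPole
  · rw [ΘBInv_of_fst_eq hS]
    intro h; rw [h] at hS; exact northPole_ne_southPole hS
  · have h8 : 8⁻¹ < ‖discBInv b‖ := by
      by_contra hle
      push Not at hle
      exact hb ⟨discBInv b, by simpa using hle, discB_discBInv hS⟩
    rw [ΘBInv, if_neg hS, Ne, discB_eq_basePt_iff]
    exact neckExpansionInv_ne_zero h8

/-- The closed inner region `discB (B̄(0, r))` is closed (image of a compact set). [folklore] -/
theorem isClosed_discB_closedBall (r : ℝ) : IsClosed (discB '' closedBall (0 : 𝔼 4) r) :=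
  ((isCompact_closedBall 0 r).image continuous_discB).isClosed

/-- **`ΘB` is smooth off `p`.** Near a point of large disc radius or over the south pole it is the
identity; elsewhere it is the conjugate of the radial expansion. [folklore] -/
theorem contMDiffAt_ΘB {b : (𝕊 2) × 𝔼 2} (hb : b ≠ basePt) :
    ContMDiffAt ((𝓡 2).prod 𝓘(ℝ, 𝔼 2)) ((𝓡 2).prod 𝓘(ℝ, 𝔼 2)) ∞ ΘB b := by
  by_cases hU : b ∈ discB '' closedBall (0 : 𝔼 4) (3 / 4)
  · -- `b = discB v`, `0 < ‖v‖ ≤ 3/4`: conjugate of the expansion on the open set `{x ≠ S}`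
    obtain ⟨v, -, rfl⟩ := hU
    have hv : v ≠ 0 := fun h => hb (by rw [h, discB_zero])
    have ho : IsOpen {b' : (𝕊 2) × 𝔼 2 | b'.1 ≠ southPole} := isOpen_ne.preimage continuous_fst
    have hev : ΘB =ᶠ[𝓝 (discB v)] fun b' => discB (neckExpansion (discBInv b')) := by
      filter_upwards [ho.mem_nhds (discB_fst_ne_southPole v)] with b' hb'
      exact ΘB_of_fst_ne hb'
    refine ContMDiffAt.congr_of_eventuallyEq ?_ hev
    have h1 : ContMDiffAt ((𝓡 2).prod 𝓘(ℝ, 𝔼 2)) 𝓘(ℝ, 𝔼 4) ∞ discBInv (discB v) :=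
      contMDiffAt_discBInv (discB_fst_ne_southPole v)
    have h2 : ContMDiffAt 𝓘(ℝ, 𝔼 4) 𝓘(ℝ, 𝔼 4) ∞ neckExpansion (discBInv (discB v)) := by
      rw [discBInv_discB]; exact (contDiffAt_neckExpansion hv).contMDiffAt
    exact contMDiff_discB.contMDiffAt.comp _ (h2.comp _ h1)
  · -- `ΘB = id` near `b`
    have ho : IsOpen (discB '' closedBall (0 : 𝔼 4) (3 / 4))ᶜ := (isClosed_discB_closedBall _).isOpen_compl
    have hev : ΘB =ᶠ[𝓝 b] id := by
      filter_upwards [ho.mem_nhds hU] with b' hb'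
      by_cases hS : b'.1 = southPole
      · exact ΘB_of_fst_eq hS
      · refine ΘB_eq_self_of_norm_discBInv hS ?_
        by_contra hlt
        push Not at hlt
        exact hb' ⟨discBInv b', by simpa using hlt.le, discB_discBInv hS⟩
    exact contMDiffAt_id.congr_of_eventuallyEq hev

/-- **`ΘBInv` is smooth off `discB (B̄(0, 1/8))`.** [folklore] -/
theorem contMDiffAt_ΘBInv {b : (𝕊 2) × 𝔼 2} (hb : b ∉ discB '' closedBall (0 : 𝔼 4) 8⁻¹) :
    ContMDiffAt ((𝓡 2).prod 𝓘(ℝ, 𝔼 2)) ((𝓡 2).prod 𝓘(ℝ, 𝔼 2)) ∞ ΘBInv b := by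
  by_cases hS : b.1 = southPole
  · -- `ΘBInv = id` near `b`: on the complement of `discB (B̄(0, 3/4))`
    have hU : b ∉ discB '' closedBall (0 : 𝔼 4) (3 / 4) := by
      rintro ⟨v, -, hvb⟩; rw [← hvb] at hS; exact discB_fst_ne_southPole v hS
    have ho : IsOpen (discB '' closedBall (0 : 𝔼 4) (3 / 4))ᶜ := (isClosed_discB_closedBall _).isOpen_compl
    have hev : ΘBInv =ᶠ[𝓝 b] id := by
      filter_upwards [ho.mem_nhds hU] with b' hb'
      by_cases hS' : b'.1 = southPole
      · exact ΘBInv_of_fst_eq hS'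
      · rw [ΘBInv, if_neg hS', neckExpansionInv_eq_self, discB_discBInv hS']
        · rfl
        · by_contra hlt
          push Not at hlt
          exact hb' ⟨discBInv b', by simpa using hlt.le, discB_discBInv hS'⟩
    exact contMDiffAt_id.congr_of_eventuallyEq hev
  · have h8 : 8⁻¹ < ‖discBInv b‖ := by
      by_contra hle
      push Not at hle
      exact hb ⟨discBInv b, by simpa using hle, discB_discBInv hS⟩
    have ho : IsOpen {b' : (𝕊 2) × 𝔼 2 | b'.1 ≠ southPole} := isOpen_ne.preimage continuous_fst
    have hev : ΘBInv =ᶠ[𝓝 b] fun b' => discB (neckExpansionInv (discBInv b')) := by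
      filter_upwards [ho.mem_nhds hS] with b' hb'
      rw [ΘBInv, if_neg hb']
    refine ContMDiffAt.congr_of_eventuallyEq ?_ hev
    exact contMDiff_discB.contMDiffAt.comp _
      ((contDiffAt_neckExpansionInv h8).contMDiffAt.comp _ (contMDiffAt_discBInv hS))

/-- **The expansion as an open partial diffeomorphism** `B ∖ {p} ≅ B ∖ discB (B̄(0, 1/8))`.
[folklore] -/
def ΘBPH : OpenPartialHomeomorph ((𝕊 2) × 𝔼 2) ((𝕊 2) × 𝔼 2) where
  toFun := ΘB
  invFun := ΘBInv
  source := {b | b ≠ basePt}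
  target := (discB '' closedBall (0 : 𝔼 4) 8⁻¹)ᶜ
  map_source' _ hb := ΘB_not_mem hb
  map_target' _ hb := ΘBInv_ne_basePt hb
  left_inv' _ hb := ΘBInv_ΘB hb
  right_inv' _ hb := ΘB_ΘBInv hb
  open_source := isOpen_ne
  open_target := (isClosed_discB_closedBall _).isOpen_compl
  continuousOn_toFun := fun _ hb => (contMDiffAt_ΘB hb).continuousAt.continuousWithinAt
  continuousOn_invFun := fun _ hb => (contMDiffAt_ΘBInv hb).continuousAt.continuousWithinAt

/-- `ΘBPH` acts as `ΘB`. [folklore] -/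
@[simp] theorem ΘBPH_apply (b : (𝕊 2) × 𝔼 2) : ΘBPH b = ΘB b := rfl

/-- Its inverse acts as `ΘBInv`. [folklore] -/
@[simp] theorem ΘBPH_symm_apply (b : (𝕊 2) × 𝔼 2) : ΘBPH.symm b = ΘBInv b := rfl

/-- Its source is `B ∖ {p}`. [folklore] -/
@[simp] theorem ΘBPH_source : ΘBPH.source = {b : (𝕊 2) × 𝔼 2 | b ≠ basePt} := rfl

/-- Its target is the complement of `discB (B̄(0, 1/8))`. [folklore] -/
@[simp] theorem ΘBPH_target : ΘBPH.target = (discB '' closedBall (0 : 𝔼 4) 8⁻¹)ᶜ := rfl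

/-- `ΘBPH` is smooth on its source. [folklore] -/
theorem contMDiffOn_ΘBPH :
    ContMDiffOn ((𝓡 2).prod 𝓘(ℝ, 𝔼 2)) ((𝓡 2).prod 𝓘(ℝ, 𝔼 2)) ∞ ΘBPH ΘBPH.source := fun _ hb =>
  (contMDiffAt_ΘB hb).contMDiffWithinAt

/-- `ΘBPH.symm` is smooth on its target. [folklore] -/
theorem contMDiffOn_ΘBPH_symm :
    ContMDiffOn ((𝓡 2).prod 𝓘(ℝ, 𝔼 2)) ((𝓡 2).prod 𝓘(ℝ, 𝔼 2)) ∞ ΘBPH.symm ΘBPH.target := fun _ hb =>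
  (contMDiffAt_ΘBInv hb).contMDiffWithinAt

/-- `ΘB b ≠ p` for `b ≠ p`. [folklore] -/
theorem ΘB_ne_basePt {b : (𝕊 2) × 𝔼 2} (hb : b ≠ basePt) : ΘB b ≠ basePt := fun h =>
  ΘB_not_mem hb ⟨0, by simp, by rw [discB_zero, h]⟩

/-! ### The two ranges and the middle sphere -/

/-- **The range of the first summand in the model**: the south-pole fibre together with the
points of blow-down radius `> 1/8` off the exceptional curve. [folklore] -/
def rangeOne : Set Model := {v | v ∈ sFibre ∨ (v ∉ excep ∧ 8⁻¹ < bdRad v)}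

/-- **The range of the second summand in the model**: `{bdRad < 1/8}` off the south-pole fibre
(this is `eTwo (ℂℙ² ∖ {q})`, `image_eTwo`). [folklore] -/
def rangeTwo : Set Model := {v | v ∉ sFibre ∧ bdRad v < 8⁻¹}

/-- The two ranges are disjoint. [folklore] -/
theorem disjoint_rangeOne_rangeTwo : Disjoint rangeOne rangeTwo := by
  rw [Set.disjoint_left]
  rintro v (hv | ⟨-, hv⟩) ⟨hv', hv''⟩
  · exact hv' hv
  · linarith

/-- `toModel (ΘB b) ∈ rangeOne` for `b ≠ p`. [folklore] -/
theorem toModel_ΘB_mem_rangeOne {b : (𝕊 2) × 𝔼 2} (hb : b ≠ basePt) : toModel (ΘB b) ∈ rangeOne := by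
  by_cases hS : b.1 = southPole
  · refine Or.inl ?_
    change (blowDown (toModel (ΘB b))).1 = southPole
    rw [ΘB_of_fst_eq hS, blowDown_toModel hb, hS]
  · have h0 : discBInv b ≠ 0 := by
      intro h0; apply hb; rw [← discB_discBInv hS, h0, discB_zero]
    have hne : neckExpansion (discBInv b) ≠ 0 := by
      intro h; have := lt_norm_neckExpansion h0; rw [h, norm_zero] at this; norm_num at this
    refine Or.inr ⟨?_, ?_⟩
    · rw [ΘB_of_fst_ne hS]; exact liftDisc_not_mem_excep hne
    · rw [ΘB_of_fst_ne hS]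
      change 8⁻¹ < bdRad (liftDisc (neckExpansion (discBInv b)))
      rw [bdRad_liftDisc hne]; exact lt_norm_neckExpansion h0

/-- **Every point of `rangeOne` is `toModel (ΘB b)` for some `b ≠ p`.** [folklore] -/
theorem exists_eq_toModel_ΘB {v : Model} (hv : v ∈ rangeOne) : ∃ b ≠ basePt, toModel (ΘB b) = v := by
  rcases hv with hv | ⟨hE, hr⟩
  · have hS : (blowDown v).1 = southPole := hv
    have hE : v ∉ excep := fun h => not_mem_sFibre_of_mem_excep h hv
    refine ⟨blowDown v, fun h => hE ((blowDown_eq_basePt_iff v).1 h), ?_⟩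
    rw [ΘB_of_fst_eq hS, toModel_blowDown hE]
  · by_cases hS : v ∈ sFibre
    · have hS' : (blowDown v).1 = southPole := hS
      refine ⟨blowDown v, fun h => hE ((blowDown_eq_basePt_iff v).1 h), ?_⟩
      rw [ΘB_of_fst_eq hS', toModel_blowDown hE]
    · obtain ⟨h1, h0⟩ := eq_liftDisc_of_not_mem hS hE
      set z := discBInv (blowDown v) with hz
      have hr' : 8⁻¹ < ‖z‖ := by rw [← h1, bdRad_liftDisc h0] at hr; exact hr
      refine ⟨discB (neckExpansionInv z), ?_, ?_⟩
      · rw [Ne, discB_eq_basePt_iff]; exact neckExpansionInv_ne_zero hr'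
      · rw [ΘB_discB, neckExpansion_neckExpansionInv hr', ← h1]; rfl

/-- **`toModel` of the end lies in `rangeOne`**: for `‖w‖ > 1/8` (in particular on `‖w‖ > 1`),
`toModel (x, w) ∈ rangeOne`. [folklore] -/
theorem toModel_mem_rangeOne_of_norm_snd {b : (𝕊 2) × 𝔼 2} (hb : 8⁻¹ < ‖b.2‖) : toModel b ∈ rangeOne := by
  have hbp : b ≠ basePt := by
    intro h; rw [h] at hb; simp [basePt] at hb; norm_num at hb
  by_cases hS : b.1 = southPole
  · refine Or.inl ?_
    change (blowDown (toModel b)).1 = southPole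
    rw [blowDown_toModel hbp, hS]
  · refine Or.inr ⟨toModel_not_mem_excep hbp, ?_⟩
    change 8⁻¹ < ‖discBInv (blowDown (toModel b))‖
    rw [blowDown_toModel hbp]
    exact hb.trans_le (norm_snd_le_norm_discBInv hS)

/-- A point of the middle sphere: `liftDisc (8⁻¹ • θ)` is in neither range. [folklore] -/
theorem liftDisc_smul_not_mem {θ : 𝔼 4} (hθ : ‖θ‖ = 1) :
    liftDisc ((8⁻¹ : ℝ) • θ) ∉ rangeOne ∧ liftDisc ((8⁻¹ : ℝ) • θ) ∉ rangeTwo := by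
  have hθ0 : θ ≠ 0 := by rintro rfl; simp at hθ
  have h0 : (8⁻¹ : ℝ) • θ ≠ 0 := smul_ne_zero (by norm_num) hθ0
  have hn : bdRad (liftDisc ((8⁻¹ : ℝ) • θ)) = 8⁻¹ := by
    rw [bdRad_liftDisc h0, norm_smul, hθ, mul_one, Real.norm_of_nonneg (by norm_num)]
  refine ⟨?_, ?_⟩
  · rintro (h | ⟨-, h⟩)
    · exact liftDisc_not_mem_sFibre h0 h
    · rw [hn] at h; exact lt_irrefl _ h
  · rintro ⟨-, h⟩
    rw [hn] at h; exact lt_irrefl _ h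

/-- **The complement of the two ranges is the middle sphere**: a point in neither range is
`liftDisc (8⁻¹ • θ)` for a unit vector `θ`. [folklore] -/
theorem exists_eq_liftDisc_of_not_mem {v : Model} (h1 : v ∉ rangeOne) (h2 : v ∉ rangeTwo) :
    ∃ θ : 𝔼 4, ‖θ‖ = 1 ∧ liftDisc ((8⁻¹ : ℝ) • θ) = v := by
  have hS : v ∉ sFibre := fun h => h1 (Or.inl h)
  have hE : v ∉ excep := by
    intro hE
    apply h2
    exact ⟨hS, by rw [bdRad_of_mem_excep hE]; norm_num⟩
  have hr : bdRad v = 8⁻¹ := by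
    by_contra hr
    rcases lt_or_gt_of_ne hr with h | h
    · exact h2 ⟨hS, h⟩
    · exact h1 (Or.inr ⟨hE, h⟩)
  obtain ⟨hv, h0⟩ := eq_liftDisc_of_not_mem hS hE
  set z := discBInv (blowDown v) with hz
  have hzn : ‖z‖ = 8⁻¹ := by rw [← hv, bdRad_liftDisc h0] at hr; exact hr
  refine ⟨‖z‖⁻¹ • z, ?_, ?_⟩
  · rw [norm_smul, norm_inv, norm_norm, inv_mul_cancel₀ (norm_ne_zero_iff.2 h0)]
  · rw [smul_smul, hzn, mul_inv_cancel₀ (by norm_num : (8⁻¹ : ℝ) ≠ 0), one_smul, hv]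

/-! ### The neck map -/

/-- **The neck map of the model** `S³ × ℝ → Ṽ`, `(θ, t) ↦ liftDisc (γ t • θ)`. [folklore] -/
def neckV (q : sphere (0 : 𝔼 4) 1 × ℝ) : Model := liftDisc (neckProfile q.2 • (q.1 : 𝔼 4))

/-- The height `0` of the neck is the middle sphere. [folklore] -/
theorem neckV_zero (θ : sphere (0 : 𝔼 4) 1) : neckV (θ, 0) = liftDisc ((8⁻¹ : ℝ) • (θ : 𝔼 4)) := by
  rw [neckV, neckProfile_zero, one_div]

/-- **Matching of the first summand**: `toModel (ΘB (discB (t • θ))) = neckV (θ, t)` for `t > 0`.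
[folklore] -/
theorem toModel_ΘB_discB_smul (θ : sphere (0 : 𝔼 4) 1) {t : ℝ} (ht : 0 < t) :
    toModel (ΘB (discB (t • (θ : 𝔼 4)))) = neckV (θ, t) := by
  rw [ΘB_discB, neckExpansion_smul (norm_eq_of_mem_sphere θ) ht, neckV, neckProfile_of_pos ht]
  rfl

/-- **Matching of the second summand**: `eTwo ((affineChart 2).symm (t • θ)) = neckV (θ, -t)` for
`t > 0`. [folklore] -/
theorem eTwo_affine₂_smul' (θ : sphere (0 : 𝔼 4) 1) {t : ℝ} (ht : 0 < t) :
    eTwo ((ComplexProjectiveSpace.affineChart (n := 2) 2).symm (t • (θ : 𝔼 4))) = neckV (θ, -t) := by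
  rw [eTwo_affine₂_smul (norm_eq_of_mem_sphere θ) ht]; rfl

/-- The points of the neck are `liftDisc` of nonzero vectors. [folklore] -/
theorem neckProfile_smul_ne_zero (q : sphere (0 : 𝔼 4) 1 × ℝ) : neckProfile q.2 • (q.1 : 𝔼 4) ≠ 0 :=
  smul_ne_zero (neckProfile_pos _).ne' (ne_zero_of_mem_unit_sphere q.1)

/-- The neck misses the two ranges exactly at height `0`: heights `t > 0` are in `rangeOne`.
[folklore] -/
theorem neckV_mem_rangeOne {q : sphere (0 : 𝔼 4) 1 × ℝ} (hq : 0 < q.2) : neckV q ∈ rangeOne := by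
  refine Or.inr ⟨liftDisc_not_mem_excep (neckProfile_smul_ne_zero q), ?_⟩
  change 8⁻¹ < bdRad (liftDisc _)
  rw [bdRad_liftDisc (neckProfile_smul_ne_zero q), norm_smul, norm_eq_of_mem_sphere q.1, mul_one,
    Real.norm_of_nonneg (neckProfile_pos _).le, ← one_div]
  exact neckProfile_gt_of_pos hq

/-- Heights `t < 0` of the neck are in `rangeTwo`. [folklore] -/
theorem neckV_mem_rangeTwo {q : sphere (0 : 𝔼 4) 1 × ℝ} (hq : q.2 < 0) : neckV q ∈ rangeTwo := by
  refine ⟨liftDisc_not_mem_sFibre (neckProfile_smul_ne_zero q), ?_⟩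
  change bdRad (liftDisc _) < 8⁻¹
  rw [bdRad_liftDisc (neckProfile_smul_ne_zero q), norm_smul, norm_eq_of_mem_sphere q.1, mul_one,
    Real.norm_of_nonneg (neckProfile_pos _).le, ← one_div]
  exact neckProfile_lt_of_neg hq

/-! #### Composition of partial diffeomorphisms -/

section TransSmooth

variable {EX HX EY HY EZ HZ : Type*}
  [NormedAddCommGroup EX] [NormedSpace ℝ EX] [TopologicalSpace HX] {IX : ModelWithCorners ℝ EX HX}
  [NormedAddCommGroup EY] [NormedSpace ℝ EY] [TopologicalSpace HY] {IY : ModelWithCorners ℝ EY HY}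
  [NormedAddCommGroup EZ] [NormedSpace ℝ EZ] [TopologicalSpace HZ] {IZ : ModelWithCorners ℝ EZ HZ}
  {X Y Z : Type*} [TopologicalSpace X] [ChartedSpace HX X] [TopologicalSpace Y] [ChartedSpace HY Y]
  [TopologicalSpace Z] [ChartedSpace HZ Z]

/-- The composite of two partial homeomorphisms which are `C^∞` on their sources is `C^∞` on its
source. [folklore] -/
theorem contMDiffOn_trans_of {e : OpenPartialHomeomorph X Y} {f : OpenPartialHomeomorph Y Z}
    (he : ContMDiffOn IX IY ∞ e e.source) (hf : ContMDiffOn IY IZ ∞ f f.source) :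
    ContMDiffOn IX IZ ∞ (e.trans f) (e.trans f).source := by
  rw [OpenPartialHomeomorph.trans_source]
  exact hf.comp (he.mono inter_subset_left) fun x hx => hx.2

/-- The inverse of the composite of two partial homeomorphisms with `C^∞` inverses is `C^∞` on its
target. [folklore] -/
theorem contMDiffOn_trans_symm_of {e : OpenPartialHomeomorph X Y} {f : OpenPartialHomeomorph Y Z}
    (he : ContMDiffOn IY IX ∞ e.symm e.target) (hf : ContMDiffOn IZ IY ∞ f.symm f.target) :
    ContMDiffOn IZ IX ∞ (e.trans f).symm (e.trans f).target := by
  rw [OpenPartialHomeomorph.trans_target]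
  exact he.comp (hf.mono inter_subset_left) fun z hz => hz.2

end TransSmooth

/-! #### The neck map as an open partial diffeomorphism -/

/-- The reparametrisation of the height by the neck profile, `(θ, t) ↦ (θ, γ t)`, as a partial
homeomorphism `S³ × ℝ ≅ S³ × (0, ∞)`. [folklore] -/
def heightPH : OpenPartialHomeomorph (sphere (0 : 𝔼 4) 1 × ℝ) (sphere (0 : 𝔼 4) 1 × ℝ) where
  toFun q := (q.1, neckProfile q.2)
  invFun q := (q.1, neckProfileInv q.2)
  source := univ
  target := univ ×ˢ Ioi 0
  map_source' q _ := ⟨mem_univ _, neckProfile_pos q.2⟩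
  map_target' _ _ := mem_univ _
  left_inv' q _ := by simp [neckProfileInv_neckProfile]
  right_inv' q hq := by
    obtain ⟨-, hq⟩ := hq
    simp [neckProfile_neckProfileInv hq]
  open_source := isOpen_univ
  open_target := isOpen_univ.prod isOpen_Ioi
  continuousOn_toFun := (continuous_fst.prodMk (continuous_neckProfile.comp continuous_snd)).continuousOn
  continuousOn_invFun := by
    rintro ⟨θ, r⟩ ⟨-, hr⟩
    exact (continuousAt_fst.prodMk ((contDiffAt_neckProfileInv_of_pos hr).continuousAt.comp
      continuousAt_snd)).continuousWithinAt

/-- `heightPH` is smooth (on its source). [folklore] -/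
theorem contMDiffOn_heightPH :
    ContMDiffOn ((𝓡 3).prod 𝓘(ℝ, ℝ)) ((𝓡 3).prod 𝓘(ℝ, ℝ)) ∞ heightPH heightPH.source :=
  (contMDiff_fst.prodMk (contDiff_neckProfile.contMDiff.comp contMDiff_snd)).contMDiffOn

/-- `heightPH.symm` is smooth on the target. [folklore] -/
theorem contMDiffOn_heightPH_symm :
    ContMDiffOn ((𝓡 3).prod 𝓘(ℝ, ℝ)) ((𝓡 3).prod 𝓘(ℝ, ℝ)) ∞ heightPH.symm heightPH.target := by
  rintro ⟨θ, r⟩ ⟨-, hr⟩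
  exact (contMDiffAt_fst.prodMk ((contDiffAt_neckProfileInv_of_pos hr).contMDiffAt.comp _
    contMDiffAt_snd)).contMDiffWithinAt

/-- The polar blow-up coordinates as a partial homeomorphism `ℝ⁴ ∖ 0 ≅ Ṽ ∖ (sFibre ∪ E)`.
[folklore] -/
def liftDiscPH : OpenPartialHomeomorph (𝔼 4) Model := discBPH.trans toModelPH

/-- `liftDiscPH` acts as `liftDisc`. [folklore] -/
@[simp] theorem liftDiscPH_apply (v : 𝔼 4) : liftDiscPH v = liftDisc v := rfl

/-- The source of `liftDiscPH` is `ℝ⁴ ∖ 0`. [folklore] -/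
theorem liftDiscPH_source : liftDiscPH.source = {v | v ≠ 0} := by
  rw [liftDiscPH, OpenPartialHomeomorph.trans_source, discBPH_source, univ_inter, toModelPH_source]
  ext v
  exact (discB_eq_basePt_iff v).not

/-- `liftDiscPH` is smooth on its source. [folklore] -/
theorem contMDiffOn_liftDiscPH : ContMDiffOn 𝓘(ℝ, 𝔼 4) 𝓘(ℝ, ℂ × ℂ) ∞ liftDiscPH liftDiscPH.source :=
  contMDiffOn_trans_of contMDiffOn_discBPH contMDiffOn_toModelPH

/-- `liftDiscPH.symm` is smooth on its target. [folklore] -/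
theorem contMDiffOn_liftDiscPH_symm :
    ContMDiffOn 𝓘(ℝ, ℂ × ℂ) 𝓘(ℝ, 𝔼 4) ∞ liftDiscPH.symm liftDiscPH.target :=
  contMDiffOn_trans_symm_of contMDiffOn_discBPH_symm contMDiffOn_toModelPH_symm

/-- A fixed point of the unit sphere of `ℝ⁴` (the junk direction of the polar inverse at `0`).
[folklore] -/
def θ₀ : sphere (0 : 𝔼 4) 1 := ⟨EuclideanSpace.single 0 1, by simp⟩

/-- **The neck map as an open partial homeomorphism** `S³ × ℝ → Ṽ` (source everything).
[folklore] -/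
def neckVPH : OpenPartialHomeomorph (sphere (0 : 𝔼 4) 1 × ℝ) Model :=
  (heightPH.trans (polar θ₀)).trans liftDiscPH

/-- `neckVPH` acts as `neckV`. [folklore] -/
@[simp] theorem neckVPH_apply (q : sphere (0 : 𝔼 4) 1 × ℝ) : neckVPH q = neckV q := rfl

/-- The source of `neckVPH` is everything. [folklore] -/
theorem neckVPH_source : neckVPH.source = univ := by
  rw [neckVPH, OpenPartialHomeomorph.trans_source, OpenPartialHomeomorph.trans_source, liftDiscPH_source]
  refine eq_univ_of_forall fun q => ⟨⟨mem_univ _, ?_⟩, ?_⟩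
  · change (q.1, neckProfile q.2) ∈ (polar θ₀).source
    rw [polar_source]; exact ⟨mem_univ _, neckProfile_pos _⟩
  · change polarVec (q.1, neckProfile q.2) ≠ 0
    exact polarVec_ne_zero (neckProfile_pos _)

/-- `neckVPH` is smooth on its source. [folklore] -/
theorem contMDiffOn_neckVPH :
    ContMDiffOn ((𝓡 3).prod 𝓘(ℝ, ℝ)) 𝓘(ℝ, ℂ × ℂ) ∞ neckVPH neckVPH.source := by
  haveI := Fact.mk (@finrank_euclideanSpace_fin ℝ _ 4)
  have hP : ContMDiffOn ((𝓡 3).prod 𝓘(ℝ, ℝ)) 𝓘(ℝ, 𝔼 4) ∞ (polar θ₀)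
      (polar θ₀).source := (contMDiff_polarVec (n := 3)).contMDiffOn
  exact contMDiffOn_trans_of (contMDiffOn_trans_of contMDiffOn_heightPH hP) contMDiffOn_liftDiscPH

/-- `neckVPH.symm` is smooth on its target. [folklore] -/
theorem contMDiffOn_neckVPH_symm :
    ContMDiffOn 𝓘(ℝ, ℂ × ℂ) ((𝓡 3).prod 𝓘(ℝ, ℝ)) ∞ neckVPH.symm neckVPH.target := by
  haveI := Fact.mk (@finrank_euclideanSpace_fin ℝ _ 4)
  have hP : ContMDiffOn 𝓘(ℝ, 𝔼 4) ((𝓡 3).prod 𝓘(ℝ, ℝ)) ∞ (polar θ₀).symm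
      (polar θ₀).target := contMDiffOn_polarInv (n := 3) _
  exact contMDiffOn_trans_symm_of (contMDiffOn_trans_symm_of contMDiffOn_heightPH_symm hP)
    contMDiffOn_liftDiscPH_symm

/-- **The neck map is smooth.** [folklore] -/
theorem contMDiff_neckV : ContMDiff ((𝓡 3).prod 𝓘(ℝ, ℝ)) 𝓘(ℝ, ℂ × ℂ) ∞ neckV := fun q =>
  (contMDiffOn_neckVPH q (by rw [neckVPH_source]; exact mem_univ q)).contMDiffAt
    (by rw [neckVPH_source]; exact Filter.univ_mem)

/-- The range of the neck map is the target of `neckVPH`, an open set. [folklore] -/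
theorem range_neckV : range neckV = neckVPH.target := by
  rw [← neckVPH.image_source_eq_target, neckVPH_source, image_univ]; rfl

/-- The range of the neck map is open. [folklore] -/
theorem isOpen_range_neckV : IsOpen (range neckV) := by rw [range_neckV]; exact neckVPH.open_target

/-- The neck map is injective. [folklore] -/
theorem neckV_injective : Injective neckV := by
  have h := neckVPH.injOn
  rw [neckVPH_source] at h
  exact fun a b hab => h (mem_univ a) (mem_univ b) hab

end ToricBlowup

end Literature.Topology.FourManifolds
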